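import Summits.QuantumFields.BalabanUV.Beta.GAN24.GaugeReadChargeTransported
import Summits.QuantumFields.BalabanUV.Beta.GAN24.WardResidualRotatedVertexTransported

/-!
# `BalabanUV.Beta.GAN24.GaugeReadChargeComb` — binder row G-an2-4 ∕ (CONV-C), CT-W «WC-TL», (Q-R) «QR-LL», the (S) row of RULING R-gan24p1-g27-1 (the OWNER gan24-p1
# g27's R14), piece (γ) = the response (gauge-read) letter **AT THE LITERAL COMB TOWER** `G_j = coDressKBmAt ρ Lc (KInvStep Lc j)`, `S_j = SpureRecAt … j`, `M1_j = M1At … j`,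
# response kernels `A_j(ν,y′) = G_j ∘ dM G_j Lc S_j M1_j ν y′` (the (γ) summand of an1's `WardLocusRecursiveStep.divW_WrecAt_of_tableLaws`, up to its scalar
# `−½·(stepScale·Lc^{d+1})⁻¹`): **THE TWO DISPLAYED HYPOTHESES OF `GaugeReadChargeMass` — (COV) AND (PER) — DISCHARGED FOR THE LITERAL, HENCE (M0)_γ AS A THEOREM: the slot-summed
# (γ) ω-charge of the comb letter VANISHES for every bounded `Lc`-periodic two-leg weight, every label, slot direction, channel, level and in-block root** — the (γ) twin of
# road-P2's `WardResidualRotatedVertexWeighted.hasSum_totalCharge_weighted_comb` ((M0) for (α)); plus the literal envelope (`hZb` socket of `SlotMomentParity`) and the literal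
# transported (γ)-letter (G-an2-4 formalisation swarm, unit `b2b-balaban-gan24-formalise-leaf-06`, gen 45; INTENT 4, sequel of INTENT 1–3 g45).

NOT IN PRINT; OUR BOOKKEEPING ([folklore] instantiation BY NAME: an2's `SecondOrderResponse.vertexFamily_dM ∕ dM_translate`, `ExpKernelCalculus.biLoc_comp_decays ∕ comp_shiftK`,
the an2-lineage translation laws `AxialDressingRooted.shiftK_coDressKBmAt_KInvStep ∕ decays_coDressKBmAt_KInvStep`, `SpineRooted.SpureRecAt_translate ∕ M1At_translate ∕
locStencil_SpureRecAt ∕ vertexFamily_M1At`, road-P2's `WardResidualRotatedVertexWeighted.tsum_weighted_shiftK_of_periodic ∕ weightedCharge_M1At_const`, and this lineage's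
INTENT 1–3; 0 `def`, 0 cited fact, 0 `def … : Prop`, 0 sorry).  HONEST FRAMING (cell contract, verbatim): «discharging `BetaPertH` makes Bałaban's UV stability UNCONDITIONAL — a
real constructive-QFT result; it is NOT the continuum limit and NOT the Clay problem.»  HONEST DEPENDENCY (verbatim): «continuum YM on T⁴ ⇐ BetaPertH ∧ nine spine estimates (0/9
proved); BetaPertH ⇐ (D1) ∧ (D4) ∧ CAP+tail; G-an2-4 gates asym, D1 and NE2/3/4.»
* §1 `exists_vertexFamily_combResponse`: the literal response kernels `A_j(ν,y′)` form a `VertexFamily` at a common rate with the literal tables (existential constants).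
* §2 **`combResponse_cov`** — (COV) for the literal: `A_j(ν, y′+s) (u + Lc•s) (x + Lc•s) = A_j(ν,y′) u x` (block-translation covariance, from the three translation laws).
* §3 **`weightedCharge_SpureRecAt_cov`** — (PER) for the literal S-table in the additive form MY INTENT 2 asks (`Z_ω(S κ (u + Lc•s)) = Z_ω(S κ u)`, `ω` jointly `Lc`-periodic);
  the M-table's is road-P2's `weightedCharge_M1At_const` verbatim.
* §4 **`hasSum_comb_gaugeCharge_mass_zero`** — (M0)_γ FOR THE LITERAL, NO DISPLAYED HYPOTHESIS LEFT: `HasSum (y′ ↦ Q^{comb}_ω(y′)) 0`;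
  `exists_envelope_comb_gaugeCharge` — the literal (γ) profile meets the `hZb` ∕ `hZ` socket UNIFORMLY (`∃ B′ δ′ > 0, ∀ y ν a b ω, |Q^{comb}_ω(y′)| ≤ B′·B_ω·e^{−δ′‖y′−y‖₁}`),
  `tsum_comb_gaugeCharge_eq_zero` (the `hM0` socket in `tsum` form).
* §5 `hasSum_prod_comb_transported_gaugeSup` — the literal transported (γ)-letter per slot `= −Lc²σ_j²·Q^{comb,face}_{αβ}(y′)` (INTENT 3 §2 at the literal `A_j`);
  **`hasSum_comb_transported_gaugeCharge_mass_zero`** — ITS MASS OVER THE SLOTS IS ZERO (the (γ) twin of road-P2's `hasSum_transported_totalCharge_comb`; road-P2's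
  `faceWeight_periodic` BY NAME for the exit-face weight's block-periodicity).
What remains DISPLAYED for the (S) row on the (γ) side: NOTHING of (M0)_γ; the slot-dipole (Π)_γ is NONZERO by itself (E19) and its cancellation is (INV) — not here.  Asserts NO value of
Bałaban's tables; discharges NOTHING of (S) beyond the (γ) summand of (M0) ∕ (INV) ∕ (Q-R) ∕ (LT) ∕ (Q-L) ∕ (C) ∕ «T2Shape» ∕ «T2Drift» ∕ (hW, hWall); NEVER «G-an2-4 closed» as (CONV-C);
NOT D1, NOT BetaPertH, NOT continuum, NOT Clay.  2026-08-22; no existing file touched.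
-/

noncomputable section

open Finset
open scoped BigOperators
open Literature.MathematicalPhysics.QuantumFieldTheory
open Literature.MathematicalPhysics.QuantumFieldTheory.Balaban1983to89
open Literature.MathematicalPhysics.QuantumFieldTheory.Balaban1983to89.Beta
open B12Sec2to5 (l1)
open ExpKernelCalculus (Site MKer BiLoc Decays VertexFamily Zl comp shiftK comp_shiftK biLoc_comp_decays)
open AffineAveraging (box toSite)
open OneStepResolventKernel (Fib wsum LocStencil decays_mono)
open OneStepKernelFamily (KInvStep)
open BalabanStepJets (locStencil_mono)
open SecondOrderResponse (dM vertexFamily_dM dM_translate)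
open InterLevelTransport (cwsum)
open Summit.QuantumFields.BalabanUV.Beta.AxialDressingRooted (coDressKBmAt decays_coDressKBmAt_KInvStep shiftK_coDressKBmAt_KInvStep)
open Summit.QuantumFields.BalabanUV.Beta.SpineRooted (SpureRecAt M1At locStencil_SpureRecAt vertexFamily_M1At SpureRecAt_translate M1At_translate)
open Summit.QuantumFields.BalabanUV.Beta.KernelWardRelative (gaugeWt)
open Summit.QuantumFields.BalabanUV.Beta.GAN24.WardResidualRotatedVertexWeighted (tsum_weighted_shiftK_of_periodic weightedCharge_M1At_const)
open Summit.QuantumFields.BalabanUV.Beta.GAN24.WardResidualRotatedVertexTransported (faceWeight_periodic)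
open Summit.QuantumFields.BalabanUV.Beta.GAN24.GaugeReadChargeProfile (abs_weightedGaugeCharge_le)
open Summit.QuantumFields.BalabanUV.Beta.GAN24.GaugeReadChargeMass (hasSum_weightedGaugeCharge_mass_zero)
open Summit.QuantumFields.BalabanUV.Beta.GAN24.GaugeReadChargeTransported (hasSum_prod_transported_gaugeSup_KInvStep
  hasSum_transported_gaugeCharge_mass_zero)

namespace Summit.QuantumFields.BalabanUV.Beta.GAN24.GaugeReadChargeComb

variable {d Lc : ℕ} [NeZero Lc]

/-! ## §1 The literal response kernels of the multiplier slots form a vertex family, at a common rate with the tables -/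

/-- [folklore] **THE LITERAL RESPONSE KERNELS `A_j(ν,y′) = G_j ∘ dM G_j Lc S_j M1_j ν y′` FORM A VERTEX FAMILY**, at ONE rate `δ > 0` shared with `LocStencil S_j` and
`VertexFamily M1_j` (an2's `vertexFamily_dM` at the common rate `m = min δ_S δ_G`, then `biLoc_comp_decays` through `G_j` at rate `m∕2 ↘ m∕4`; the tables re-read at `m∕4` by
monotonicity — an1's `WardLocusResidualClass.exists_vertexFamily_residual` pattern).  Constants existential: none of them enters the (M0) statements below. -/
theorem exists_vertexFamily_combResponse (hLc : 1 ≤ Lc) {r : Fin (d + 1) → ℕ} (hr : r ∈ box (d + 1) Lc) (cE cVH cΛ : ℝ) (j : ℕ) :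
    ∃ CA Cs CM δ : ℝ, 0 < δ ∧
      VertexFamily (fun ν y' => comp (coDressKBmAt (toSite r) Lc (KInvStep (d := d) Lc j))
        (dM (coDressKBmAt (toSite r) Lc (KInvStep (d := d) Lc j)) Lc (SpureRecAt d Lc (toSite r) cE cVH cΛ j) (M1At d Lc (toSite r) cΛ j) ν y')) Lc CA δ ∧
      LocStencil (SpureRecAt d Lc (toSite r) cE cVH cΛ j) Cs δ ∧ VertexFamily (M1At d Lc (toSite r) cΛ j) Lc CM δ := by
  obtain ⟨δG, CG, hδG, hCG, hG⟩ := decays_coDressKBmAt_KInvStep (d := d) hr j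
  obtain ⟨Cs, δs, hδs, hS⟩ := locStencil_SpureRecAt (d := d) (Lc := Lc) hLc hr cE cVH cΛ j
  have hCs : 0 ≤ Cs := (hS 0 0).nonneg (Sum.inl 0)
  set m : ℝ := min δs δG with hm
  have hm0 : 0 < m := lt_min hδs hδG
  have hSm : LocStencil (SpureRecAt d Lc (toSite r) cE cVH cΛ j) Cs m := locStencil_mono hS hCs (min_le_left _ _)
  have hMm := vertexFamily_M1At (d := d) hLc hr cΛ j hm0.le
  have hV := vertexFamily_dM (N := Lc) hG hCG hSm hMm hm0 (min_le_right _ _)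
  have hG2 : Decays (coDressKBmAt (toSite r) Lc (KInvStep (d := d) Lc j)) CG (m / 2) :=
    decays_mono hG hCG le_rfl (by linarith [min_le_right δs δG])
  refine ⟨_, Cs, _, m / 4, by positivity, fun ν y' => biLoc_comp_decays hG2 (hV ν y') (by positivity) (by linarith),
    locStencil_mono hS hCs (by linarith [min_le_left δs δG]), vertexFamily_M1At (d := d) hLc hr cΛ j (by positivity)⟩

/-! ## §2 (COV) for the literal: joint block-translation covariance of the response kernels -/

omit [NeZero Lc] in
/-- [folklore] A shifted kernel evaluated at shifted points: `shiftK (−v) K (u + v) (x + v) = K u x`. -/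
theorem shiftK_neg_apply_add (v : Site (d + 1)) (K : MKer (d + 1) (Fib d)) (u x : Site (d + 1)) (rr c : Fib d) :
    shiftK (-v) K (u + v) (x + v) rr c = K u x rr c := by
  simp only [shiftK, add_neg_cancel_right]

/-- NOT IN PRINT; OUR BOOKKEEPING.  **(COV) FOR THE LITERAL**: `A_j(ν, y′ + s) (u + Lc•s) (x + Lc•s) = A_j(ν, y′) u x` — the response kernel of the slot translated by `s` is the
block translate of the response kernel (an2's `dM_translate` with `shiftK_coDressKBmAt_KInvStep`, `SpureRecAt_translate`, `M1At_translate`, then `comp_shiftK`).  This is the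
hypothesis `hAcov` of `GaugeReadChargeMass.hasSum_weightedGaugeCharge_mass_zero` for the literal family. -/
theorem combResponse_cov (hLc : 1 ≤ Lc) (r : Fin (d + 1) → ℕ) (cE cVH cΛ : ℝ) (j : ℕ) (ν : Fin (d + 1)) (y' s u x : Site (d + 1)) (rr c : Fib d) :
    comp (coDressKBmAt (toSite r) Lc (KInvStep (d := d) Lc j))
        (dM (coDressKBmAt (toSite r) Lc (KInvStep (d := d) Lc j)) Lc (SpureRecAt d Lc (toSite r) cE cVH cΛ j) (M1At d Lc (toSite r) cΛ j) ν (y' + s))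
        (u + (Lc : ℤ) • s) (x + (Lc : ℤ) • s) rr c
      = comp (coDressKBmAt (toSite r) Lc (KInvStep (d := d) Lc j))
        (dM (coDressKBmAt (toSite r) Lc (KInvStep (d := d) Lc j)) Lc (SpureRecAt d Lc (toSite r) cE cVH cΛ j) (M1At d Lc (toSite r) cΛ j) ν y') u x rr c := by
  have hD := dM_translate (N := Lc) (fun t => shiftK_coDressKBmAt_KInvStep (d := d) (toSite r) j t)
    (SpureRecAt_translate (toSite r) hLc cE cVH cΛ j) (M1At_translate (Lc := Lc) (toSite r) cΛ j) ν y' s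
  have hGs := shiftK_coDressKBmAt_KInvStep (d := d) (Lc := Lc) (toSite r) j s
  have e : comp (coDressKBmAt (toSite r) Lc (KInvStep (d := d) Lc j))
      (dM (coDressKBmAt (toSite r) Lc (KInvStep (d := d) Lc j)) Lc (SpureRecAt d Lc (toSite r) cE cVH cΛ j) (M1At d Lc (toSite r) cΛ j) ν (y' + s))
      = shiftK (-((Lc : ℤ) • s)) (comp (coDressKBmAt (toSite r) Lc (KInvStep (d := d) Lc j))
        (dM (coDressKBmAt (toSite r) Lc (KInvStep (d := d) Lc j)) Lc (SpureRecAt d Lc (toSite r) cE cVH cΛ j) (M1At d Lc (toSite r) cΛ j) ν y')) := by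
    rw [hD, ← comp_shiftK, hGs]
  rw [e, shiftK_neg_apply_add]

/-! ## §3 (PER) for the literal S-table in additive form -/

/-- NOT IN PRINT; OUR BOOKKEEPING.  **(PER) FOR THE LITERAL S-TABLE**: for a two-leg weight invariant under SIMULTANEOUS block shifts, `Z_ω(S_j κ (u + Lc•s)) = Z_ω(S_j κ u)`
(`SpureRecAt_translate` + road-P2's `tsum_weighted_shiftK_of_periodic`; road-P2's `weightedCharge_SpureRecAt_block` is the same fact in block coordinates).  The M-table's
(PER) is road-P2's `weightedCharge_M1At_const` verbatim (slot-free). -/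
theorem weightedCharge_SpureRecAt_cov (hLc : 1 ≤ Lc) (r : Fin (d + 1) → ℕ) (cE cVH cΛ : ℝ) (j : ℕ) (a b : Fib d)
    {ω : Site (d + 1) × Site (d + 1) → ℝ} (hωp : ∀ (s : Site (d + 1)) (xz : Site (d + 1) × Site (d + 1)), ω (xz.1 + (Lc : ℤ) • s, xz.2 + (Lc : ℤ) • s) = ω xz)
    (κ : Fin (d + 1)) (u s : Site (d + 1)) :
    ∑' xz : Site (d + 1) × Site (d + 1), ω xz * SpureRecAt d Lc (toSite r) cE cVH cΛ j κ (u + (Lc : ℤ) • s) xz.1 xz.2 a b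
      = ∑' xz : Site (d + 1) × Site (d + 1), ω xz * SpureRecAt d Lc (toSite r) cE cVH cΛ j κ u xz.1 xz.2 a b := by
  rw [SpureRecAt_translate (toSite r) hLc cE cVH cΛ j κ u s]
  refine tsum_weighted_shiftK_of_periodic _ (fun xz => ?_) _ a b
  have h := hωp (-s) xz
  rwa [smul_neg] at h

/-! ## §4 (M0)_γ for the literal comb letter — no displayed hypothesis left; and the literal envelope -/

/-- NOT IN PRINT; OUR BOOKKEEPING.  **(M0)_γ FOR THE LITERAL COMB LETTER.**  For every level `j`, in-block root `r`, label `y`, slot direction `ν`, channel `(a, b)`, all table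
parameters `cE cVH cΛ`, and every bounded two-leg weight `ω` invariant under simultaneous block shifts: the (γ) ω-charge of the slot `(ν, y′)` — the response kernel
`A_j(ν,y′) = G_j ∘ dM G_j Lc S_j M1_j ν y′` read against the gauge weight `ĝ_y`, fed into the tables `S_j`, `M1_j`, then ω-charged — SUMS TO ZERO OVER THE SLOTS `y′`:
`HasSum (y′ ↦ Q^{comb}_ω(y′)) 0`.  INTENT 2's `hasSum_weightedGaugeCharge_mass_zero` with (COV) := §2, (PER) := §3 + road-P2's `weightedCharge_M1At_const`, the families from §1.
The (γ) twin of road-P2's `hasSum_totalCharge_weighted_comb`; together they make the (α) + (γ) summand of W-Z0 a theorem for the literal. -/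
theorem hasSum_comb_gaugeCharge_mass_zero (hLc : 1 ≤ Lc) {r : Fin (d + 1) → ℕ} (hr : r ∈ box (d + 1) Lc) (cE cVH cΛ : ℝ) (j : ℕ)
    (y : Site (d + 1)) (ν : Fin (d + 1)) (a b : Fib d) {ω : Site (d + 1) × Site (d + 1) → ℝ} {B : ℝ} (hω : ∀ xz, |ω xz| ≤ B)
    (hωp : ∀ (s : Site (d + 1)) (xz : Site (d + 1) × Site (d + 1)), ω (xz.1 + (Lc : ℤ) • s, xz.2 + (Lc : ℤ) • s) = ω xz) :
    HasSum (fun y' : Site (d + 1) =>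
        ∑ κ, ∑' u, (∑' x₂, ∑ κ₂,
              comp (coDressKBmAt (toSite r) Lc (KInvStep (d := d) Lc j))
                (dM (coDressKBmAt (toSite r) Lc (KInvStep (d := d) Lc j)) Lc (SpureRecAt d Lc (toSite r) cE cVH cΛ j) (M1At d Lc (toSite r) cΛ j) ν y')
                u x₂ (Sum.inl κ) (Sum.inl κ₂) * gaugeWt Lc y κ₂ x₂) *
              ∑' xz : Site (d + 1) × Site (d + 1), ω xz * SpureRecAt d Lc (toSite r) cE cVH cΛ j κ u xz.1 xz.2 a b
          + ∑ ρ', ∑' w, (∑' x₂, ∑ κ₂,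
              comp (coDressKBmAt (toSite r) Lc (KInvStep (d := d) Lc j))
                (dM (coDressKBmAt (toSite r) Lc (KInvStep (d := d) Lc j)) Lc (SpureRecAt d Lc (toSite r) cE cVH cΛ j) (M1At d Lc (toSite r) cΛ j) ν y')
                ((Lc : ℤ) • w) x₂ (Sum.inr ρ') (Sum.inl κ₂) * gaugeWt Lc y κ₂ x₂) *
              ∑' xz : Site (d + 1) × Site (d + 1), ω xz * M1At d Lc (toSite r) cΛ j ρ' w xz.1 xz.2 a b) 0 := by
  obtain ⟨CA, Cs, CM, δ, hδ, hA, hS, hM⟩ := exists_vertexFamily_combResponse hLc hr cE cVH cΛ j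
  exact hasSum_weightedGaugeCharge_mass_zero hLc hA hδ hS hM y ν a b hω
    (fun y' s u x rr c => combResponse_cov hLc r cE cVH cΛ j ν y' s u x rr c)
    (fun κ u s => weightedCharge_SpureRecAt_cov hLc r cE cVH cΛ j a b hωp κ u s)
    (fun ρ' w s => weightedCharge_M1At_const (toSite r) cΛ j a b hωp ρ' (w + s) w)

/-- NOT IN PRINT; OUR BOOKKEEPING.  **THE LITERAL (γ) PROFILE MEETS THE `hZb` ∕ `hZ` SOCKET, UNIFORMLY** (`SlotMomentParity.moments_of_slotInv`, the OWNER g28's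
`WardRemainderEndThree` row `hZ`): for every level `j` and in-block root there are `B′` and `δ′ > 0` (existential; level-dependent by design) such that for EVERY label `y`, slot
direction `ν`, channel `(a,b)`, bounded weight `|ω| ≤ B` and slot `y′`: `|Q^{comb}_ω(y′)| ≤ B′·B·e^{−δ′‖y′ − y‖₁}` — ONE constant for all labels, directions, channels and weights
(INTENT 1's `abs_weightedGaugeCharge_le` at the families of §1; its bound is linear in the weight bound `B`). -/
theorem exists_envelope_comb_gaugeCharge (hLc : 1 ≤ Lc) {r : Fin (d + 1) → ℕ} (hr : r ∈ box (d + 1) Lc) (cE cVH cΛ : ℝ) (j : ℕ) :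
    ∃ B' δ' : ℝ, 0 < δ' ∧ ∀ (y : Site (d + 1)) (ν : Fin (d + 1)) (a b : Fib d) (ω : Site (d + 1) × Site (d + 1) → ℝ) (B : ℝ),
      (∀ xz, |ω xz| ≤ B) → ∀ y' : Site (d + 1),
      |∑ κ, ∑' u, (∑' x₂, ∑ κ₂,
              comp (coDressKBmAt (toSite r) Lc (KInvStep (d := d) Lc j))
                (dM (coDressKBmAt (toSite r) Lc (KInvStep (d := d) Lc j)) Lc (SpureRecAt d Lc (toSite r) cE cVH cΛ j) (M1At d Lc (toSite r) cΛ j) ν y')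
                u x₂ (Sum.inl κ) (Sum.inl κ₂) * gaugeWt Lc y κ₂ x₂) *
              ∑' xz : Site (d + 1) × Site (d + 1), ω xz * SpureRecAt d Lc (toSite r) cE cVH cΛ j κ u xz.1 xz.2 a b
          + ∑ ρ', ∑' w, (∑' x₂, ∑ κ₂,
              comp (coDressKBmAt (toSite r) Lc (KInvStep (d := d) Lc j))
                (dM (coDressKBmAt (toSite r) Lc (KInvStep (d := d) Lc j)) Lc (SpureRecAt d Lc (toSite r) cE cVH cΛ j) (M1At d Lc (toSite r) cΛ j) ν y')
                ((Lc : ℤ) • w) x₂ (Sum.inr ρ') (Sum.inl κ₂) * gaugeWt Lc y κ₂ x₂) *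
              ∑' xz : Site (d + 1) × Site (d + 1), ω xz * M1At d Lc (toSite r) cΛ j ρ' w xz.1 xz.2 a b|
        ≤ B' * B * Real.exp (-δ' * l1 (y' - y)) := by
  obtain ⟨CA, Cs, CM, δ, hδ, hA, hS, hM⟩ := exists_vertexFamily_combResponse hLc hr cE cVH cΛ j
  refine ⟨(d + 1 : ℕ) * ((d + 1 : ℕ) * CA * Zl (d + 1) (δ / 2) * Real.exp ((δ / 2) * (((d : ℝ) + 1) * Lc + 1)))
      * ((Cs + CM) * (Zl (d + 1) δ * Zl (d + 1) δ)) * Zl (d + 1) δ, δ / 2, half_pos hδ, fun y ν a b ω B hω y' => ?_⟩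
  refine (abs_weightedGaugeCharge_le hLc hA hδ hS hM y ν a b hω y').trans (le_of_eq ?_)
  ring

/-- NOT IN PRINT; OUR BOOKKEEPING.  **(M0)_γ FOR THE LITERAL IN `tsum` FORM** — the OWNER g28's `WardRemainderEndThree` row `hM0` ∕ `SlotMomentParity`'s `hM0` verbatim:
`Σ'_{y′} Q^{comb}_ω(y′) = 0` (from `hasSum_comb_gaugeCharge_mass_zero`). -/
theorem tsum_comb_gaugeCharge_eq_zero (hLc : 1 ≤ Lc) {r : Fin (d + 1) → ℕ} (hr : r ∈ box (d + 1) Lc) (cE cVH cΛ : ℝ) (j : ℕ)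
    (y : Site (d + 1)) (ν : Fin (d + 1)) (a b : Fib d) {ω : Site (d + 1) × Site (d + 1) → ℝ} {B : ℝ} (hω : ∀ xz, |ω xz| ≤ B)
    (hωp : ∀ (s : Site (d + 1)) (xz : Site (d + 1) × Site (d + 1)), ω (xz.1 + (Lc : ℤ) • s, xz.2 + (Lc : ℤ) • s) = ω xz) :
    ∑' y' : Site (d + 1),
        (∑ κ, ∑' u, (∑' x₂, ∑ κ₂,
              comp (coDressKBmAt (toSite r) Lc (KInvStep (d := d) Lc j))
                (dM (coDressKBmAt (toSite r) Lc (KInvStep (d := d) Lc j)) Lc (SpureRecAt d Lc (toSite r) cE cVH cΛ j) (M1At d Lc (toSite r) cΛ j) ν y')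
                u x₂ (Sum.inl κ) (Sum.inl κ₂) * gaugeWt Lc y κ₂ x₂) *
              ∑' xz : Site (d + 1) × Site (d + 1), ω xz * SpureRecAt d Lc (toSite r) cE cVH cΛ j κ u xz.1 xz.2 a b
          + ∑ ρ', ∑' w, (∑' x₂, ∑ κ₂,
              comp (coDressKBmAt (toSite r) Lc (KInvStep (d := d) Lc j))
                (dM (coDressKBmAt (toSite r) Lc (KInvStep (d := d) Lc j)) Lc (SpureRecAt d Lc (toSite r) cE cVH cΛ j) (M1At d Lc (toSite r) cΛ j) ν y')
                ((Lc : ℤ) • w) x₂ (Sum.inr ρ') (Sum.inl κ₂) * gaugeWt Lc y κ₂ x₂) *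
              ∑' xz : Site (d + 1) × Site (d + 1), ω xz * M1At d Lc (toSite r) cΛ j ρ' w xz.1 xz.2 a b) = 0 :=
  (hasSum_comb_gaugeCharge_mass_zero hLc hr cE cVH cΛ j y ν a b hω hωp).tsum_eq

/-! ## §5 The literal transported (γ)-letter per slot -/

/-- NOT IN PRINT; OUR BOOKKEEPING.  **THE LITERAL TRANSPORTED (γ)-LETTER PER SLOT** — the (γ) twin of road-P2's `hasSum_prod_transported_rotatedVertex_comb`: the coarse
field–field entries of `G_j ∘ 𝒢[A_j(ν,y′)](ĝ_y) ∘ G_j` have `HasSum` over `(x′,z′)` equal to `−Lc²·σ_j²·Q^{comb,face}_{αβ}(y′)`, `σ_j = ((Lc^{j+1})^{d+2})⁻¹`, `Q^{comb,face}_{αβ}` the literal (γ)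
ω-charge at the exit-face weight `𝟙[x_α % Lc = Lc−1 ∧ z_β % Lc = Lc−1]`, channel `(inl α, inl β)` (INTENT 3 §2 at the family of §1). -/
theorem hasSum_prod_comb_transported_gaugeSup (hLc : 1 ≤ Lc) {r : Fin (d + 1) → ℕ} (hr : r ∈ box (d + 1) Lc) (cE cVH cΛ : ℝ) (j : ℕ)
    (y : Site (d + 1)) (ν : Fin (d + 1)) (y' : Site (d + 1)) (α β : Fin (d + 1)) :
    HasSum (fun xz : Site (d + 1) × Site (d + 1) =>
        comp (comp (coDressKBmAt (toSite r) Lc (KInvStep (d := d) Lc j))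
          (∑ κ, wsum (fun u => ∑' x₂, ∑ κ₂,
              comp (coDressKBmAt (toSite r) Lc (KInvStep (d := d) Lc j))
                (dM (coDressKBmAt (toSite r) Lc (KInvStep (d := d) Lc j)) Lc (SpureRecAt d Lc (toSite r) cE cVH cΛ j) (M1At d Lc (toSite r) cΛ j) ν y')
                u x₂ (Sum.inl κ) (Sum.inl κ₂) * gaugeWt Lc y κ₂ x₂) (SpureRecAt d Lc (toSite r) cE cVH cΛ j κ)
            + ∑ ρ', cwsum Lc (fun w => ∑' x₂, ∑ κ₂,
              comp (coDressKBmAt (toSite r) Lc (KInvStep (d := d) Lc j))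
                (dM (coDressKBmAt (toSite r) Lc (KInvStep (d := d) Lc j)) Lc (SpureRecAt d Lc (toSite r) cE cVH cΛ j) (M1At d Lc (toSite r) cΛ j) ν y')
                ((Lc : ℤ) • w) x₂ (Sum.inr ρ') (Sum.inl κ₂) * gaugeWt Lc y κ₂ x₂) (M1At d Lc (toSite r) cΛ j ρ')))
          (coDressKBmAt (toSite r) Lc (KInvStep (d := d) Lc j)) ((Lc : ℤ) • xz.1) ((Lc : ℤ) • xz.2) (Sum.inr α) (Sum.inr β))
      (-((Lc : ℝ) ^ 2 * (((((Lc ^ (j + 1) : ℕ) : ℝ)) ^ (d + 1 + 1))⁻¹) ^ 2 *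
        (∑ κ, ∑' u, (∑' x₂, ∑ κ₂,
              comp (coDressKBmAt (toSite r) Lc (KInvStep (d := d) Lc j))
                (dM (coDressKBmAt (toSite r) Lc (KInvStep (d := d) Lc j)) Lc (SpureRecAt d Lc (toSite r) cE cVH cΛ j) (M1At d Lc (toSite r) cΛ j) ν y')
                u x₂ (Sum.inl κ) (Sum.inl κ₂) * gaugeWt Lc y κ₂ x₂) *
              ∑' xz : Site (d + 1) × Site (d + 1),
                (if xz.1 α % (Lc : ℤ) = (Lc : ℤ) - 1 ∧ xz.2 β % (Lc : ℤ) = (Lc : ℤ) - 1 then (1 : ℝ) else 0)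
                  * SpureRecAt d Lc (toSite r) cE cVH cΛ j κ u xz.1 xz.2 (Sum.inl α) (Sum.inl β)
          + ∑ ρ', ∑' w, (∑' x₂, ∑ κ₂,
              comp (coDressKBmAt (toSite r) Lc (KInvStep (d := d) Lc j))
                (dM (coDressKBmAt (toSite r) Lc (KInvStep (d := d) Lc j)) Lc (SpureRecAt d Lc (toSite r) cE cVH cΛ j) (M1At d Lc (toSite r) cΛ j) ν y')
                ((Lc : ℤ) • w) x₂ (Sum.inr ρ') (Sum.inl κ₂) * gaugeWt Lc y κ₂ x₂) *
              ∑' xz : Site (d + 1) × Site (d + 1),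
                (if xz.1 α % (Lc : ℤ) = (Lc : ℤ) - 1 ∧ xz.2 β % (Lc : ℤ) = (Lc : ℤ) - 1 then (1 : ℝ) else 0)
                  * M1At d Lc (toSite r) cΛ j ρ' w xz.1 xz.2 (Sum.inl α) (Sum.inl β)))) := by
  obtain ⟨CA, Cs, CM, δ, hδ, hA, hS, hM⟩ := exists_vertexFamily_combResponse hLc hr cE cVH cΛ j
  exact hasSum_prod_transported_gaugeSup_KInvStep hLc hr j (hA ν y') hδ hS hM y α β

/-- NOT IN PRINT; OUR BOOKKEEPING.  **THE LITERAL TRANSPORTED (γ)-CHARGE HAS ZERO MASS** — the (γ) twin of road-P2's `WardResidualRotatedVertexTransported.hasSum_transported_totalCharge_comb`: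
the per-slot values of §5 (`−Lc²σ_j²·Q^{comb,face}_{αβ}(y′)`) SUM TO ZERO over the slots `y′`, for every level, in-block root, label, slot direction and coarse channel `(α, β)` — INTENT 3's
`hasSum_transported_gaugeCharge_mass_zero` with (COV) := §2 and (PER at the exit-face weight) := §3 + road-P2's `weightedCharge_M1At_const`, the face weight's simultaneous-shift
periodicity being road-P2's `faceWeight_periodic`.  No displayed hypothesis left. -/
theorem hasSum_comb_transported_gaugeCharge_mass_zero (hLc : 1 ≤ Lc) {r : Fin (d + 1) → ℕ} (hr : r ∈ box (d + 1) Lc) (cE cVH cΛ : ℝ) (j : ℕ)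
    (y : Site (d + 1)) (ν α β : Fin (d + 1)) :
    HasSum (fun y' : Site (d + 1) => -((Lc : ℝ) ^ 2 * (((((Lc ^ (j + 1) : ℕ) : ℝ)) ^ (d + 1 + 1))⁻¹) ^ 2 *
        (∑ κ, ∑' u, (∑' x₂, ∑ κ₂,
              comp (coDressKBmAt (toSite r) Lc (KInvStep (d := d) Lc j))
                (dM (coDressKBmAt (toSite r) Lc (KInvStep (d := d) Lc j)) Lc (SpureRecAt d Lc (toSite r) cE cVH cΛ j) (M1At d Lc (toSite r) cΛ j) ν y')
                u x₂ (Sum.inl κ) (Sum.inl κ₂) * gaugeWt Lc y κ₂ x₂) *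
              ∑' xz : Site (d + 1) × Site (d + 1),
                (if xz.1 α % (Lc : ℤ) = (Lc : ℤ) - 1 ∧ xz.2 β % (Lc : ℤ) = (Lc : ℤ) - 1 then (1 : ℝ) else 0)
                  * SpureRecAt d Lc (toSite r) cE cVH cΛ j κ u xz.1 xz.2 (Sum.inl α) (Sum.inl β)
          + ∑ ρ', ∑' w, (∑' x₂, ∑ κ₂,
              comp (coDressKBmAt (toSite r) Lc (KInvStep (d := d) Lc j))
                (dM (coDressKBmAt (toSite r) Lc (KInvStep (d := d) Lc j)) Lc (SpureRecAt d Lc (toSite r) cE cVH cΛ j) (M1At d Lc (toSite r) cΛ j) ν y')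
                ((Lc : ℤ) • w) x₂ (Sum.inr ρ') (Sum.inl κ₂) * gaugeWt Lc y κ₂ x₂) *
              ∑' xz : Site (d + 1) × Site (d + 1),
                (if xz.1 α % (Lc : ℤ) = (Lc : ℤ) - 1 ∧ xz.2 β % (Lc : ℤ) = (Lc : ℤ) - 1 then (1 : ℝ) else 0)
                  * M1At d Lc (toSite r) cΛ j ρ' w xz.1 xz.2 (Sum.inl α) (Sum.inl β)))) 0 := by
  classical
  obtain ⟨CA, Cs, CM, δ, hδ, hA, hS, hM⟩ := exists_vertexFamily_combResponse hLc hr cE cVH cΛ j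
  have hωp : ∀ (s : Site (d + 1)) (xz : Site (d + 1) × Site (d + 1)),
      (fun xz : Site (d + 1) × Site (d + 1) => if xz.1 α % (Lc : ℤ) = (Lc : ℤ) - 1 ∧ xz.2 β % (Lc : ℤ) = (Lc : ℤ) - 1 then (1 : ℝ) else 0)
          (xz.1 + (Lc : ℤ) • s, xz.2 + (Lc : ℤ) • s)
        = (fun xz : Site (d + 1) × Site (d + 1) => if xz.1 α % (Lc : ℤ) = (Lc : ℤ) - 1 ∧ xz.2 β % (Lc : ℤ) = (Lc : ℤ) - 1 then (1 : ℝ) else 0) xz :=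
    fun s xz => faceWeight_periodic α β s xz
  exact hasSum_transported_gaugeCharge_mass_zero hLc hA hδ hS hM y ν α β _
    (fun y' s u x rr c => combResponse_cov hLc r cE cVH cΛ j ν y' s u x rr c)
    (fun κ u s => weightedCharge_SpureRecAt_cov hLc r cE cVH cΛ j (Sum.inl α) (Sum.inl β) hωp κ u s)
    (fun ρ' w s => weightedCharge_M1At_const (toSite r) cΛ j (Sum.inl α) (Sum.inl β) hωp ρ' (w + s) w)

end Summit.QuantumFields.BalabanUV.Beta.GAN24.GaugeReadChargeComb

end
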